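import Summits.AtomisticToContinuum.BoseEinsteinCondensation.Theses.BECHusimiAmplitudeGas
import Summits.AtomisticToContinuum.BoseEinsteinCondensation.Theorems.BECConjugateDominationNearMinimiserStability
import Summits.AtomisticToContinuum.BoseEinsteinCondensation.Theorems.BECConjugateDominationHardCoreExtensionBoundedPositiveMinimiserHolds
import Literature.MathematicalPhysics.QuantumManyBody.PeriodicGroundStateNondegenerateProofs

/-!
# `PeriodicBECNonneg` — ground-state reduction on the bounded sector (route BECHusimiAmplitudeGas)

Helper file for the node `PeriodicBECNonneg` (item stmt-AtomisticToContinuum-11996): for BOUNDED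
admissible pair potentials `v` (measurable, finite range, `v ≤ M < ∞`) the node's hypothesis class
"nonnegative periodic `δ`-near-minimisers, `δ = δ(N) > 0` chosen after `N`" carries exactly the
content of the positive ground state, and the sign condition is immaterial:

* `nearMinimiserStability_of_bounded` — UNCONDITIONAL near-minimiser stability for the bounded
  class: at fixed `N`, `L > 0`, `ε > 0` there is `δ > 0` with `n₀(Ψ) ≤ n₀(Φ) + εN` for every
  minimiser `Ψ` and every `δ`-near-minimiser `Φ` (the gap argument of
  `nearMinimiserStability_of_nondegenerate`, route BECConjugateDomination, run for bounded measurable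
  `v` — only boundedness of the periodisation is used there — and fed with the tree's
  `PeriodicGroundStateNondegenerate_holds`).
* `eventually_nearMinimiser_condensate_of_groundState` — if, along `L_N = (N/ρ)^{1/3}`, the
  nonnegative minimisers have `n₀ ≥ cN` for all large `N`, then for all large `N` some `δ_N > 0`
  makes EVERY `δ_N`-near-minimiser (signed or not) satisfy `n₀ ≥ (c/2)N` (stability with `ε = c/2`
  against the positive `C¹` minimiser of `boundedPositiveMinimiser_holds`).
* `periodicBEC_body_of_groundStateBEC_bounded`, `periodicBECNonneg_body_of_groundStateBEC_bounded`,
  `groundStateBEC_of_periodicBECNonneg_body`, `periodicBECNonneg_body_iff_groundStateBEC_bounded` —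
  on the bounded sector: node body `⇔` ground-state BEC (`∃ c > 0`, eventually every nonnegative
  minimiser has `n₀ ≥ cN`) `⇔` the unsigned periodic-BEC body.
* `periodicBEC_body_of_periodicBECNonneg_body_bounded` — the bounded sector of
  `PositivityReduction` (item stmt-AtomisticToContinuum-11998) for free.
* `periodicBECNonneg_of_groundStateBEC` — the node follows from ground-state BEC of the bounded
  potentials together with the node body on the unbounded ones (hard cores etc., where existence of
  `C¹` minimisers is the sibling routes' `HardCoreExtension` business).

No new mathematics beyond the tree: Perron–Frobenius minimiser (`boundedPositiveMinimiser_holds`),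
simplicity of the bosonic ground state (`PeriodicGroundStateNondegenerate_holds`), min–max gap
inequality and the `2N`-Lipschitz bound for `n₀` (route BECConjugateDomination's stability file).
-/

noncomputable section

open MeasureTheory Filter Set Complex
open scoped ENNReal NNReal Topology ComplexConjugate InnerProductSpace

namespace Summit.AtomisticToContinuum.BoseEinsteinCondensation.Theorems

open Summit.AtomisticToContinuum.BoseEinsteinCondensation.Theses.BECHusimiAmplitudeGas
open Literature.MathematicalPhysics.QuantumManyBody
open Literature.MathematicalPhysics.QuantumManyBody.BoseGas Literature.Analysis.InnerProduct
open Summit.AtomisticToContinuum.BoseEinsteinCondensation.Cruxes.HardCoreExtension.ThirdLawCurrentFloor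
  (boundedPositiveMinimiser_holds)

/-! ### Near-minimiser stability for bounded measurable potentials (unconditional) -/
set_option maxHeartbeats 400000 in
/-- **Near-minimiser stability, bounded admissible class (unconditional).** For a repulsive
finite-range measurable pair potential with `v ≤ M < ∞`, fixed `N`, `L > 0` and `ε > 0`, there is
`δ > 0` such that every minimiser `Ψ` and every `δ`-near-minimiser `Φ` of the periodic `N`-body energy
(periodic `C¹` Bose trial states) satisfy `n₀(Ψ) ≤ n₀(Φ) + εN`. Proof: verbatim the gap argument of
`nearMinimiserStability_of_nondegenerate` (min–max `TwoModeData` of `formEmbed`, gap inequality, phase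
alignment, `2N`-Lipschitz bound for `n₀`), with the bounded periodisation supplied by
`exists_bound_periodizedPotential` from `v ≤ M` and the gap by `PeriodicGroundStateNondegenerate_holds`.
[cite: ReedSimonIV1978, Thm. XIII.1 and §XIII.12 Thms XIII.43–XIII.46] -/
theorem nearMinimiserStability_of_bounded {v : ℝ → ℝ≥0∞} (hv : IsRepulsiveFiniteRange v)
    {M : ℝ≥0} (hM : ∀ r, v r ≤ M) (N : ℕ) {L : ℝ} (hL : 0 < L) {ε : ℝ} (hε : 0 < ε) :
    ∃ δ : ℝ≥0∞, 0 < δ ∧ ∀ Ψ Φ : PeriodicTrialState N L,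
      periodicEnergy v Ψ = periodicGroundStateEnergy v N L →
      periodicEnergy v Φ ≤ periodicGroundStateEnergy v N L + δ →
      condensateOccupation N L Ψ.ψ ≤ condensateOccupation N L Φ.ψ + ENNReal.ofReal (ε * N) := by
  obtain ⟨hmeas, R₀, hR₀⟩ := hv
  rcases N with _ | n
  · -- no particles: `n₀ = 0`
    refine ⟨1, one_pos, fun Ψ Φ _ _ => ?_⟩
    simp [condensateOccupation, occupation]
  -- bounded periodisation, `W ∈ L¹(cell)`
  obtain ⟨C, hC⟩ := exists_bound_periodizedPotential hL hM hR₀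
  have hW : ∫⁻ X in cellN (n + 1) L, periodicInteraction v L X ≠ ⊤ :=
    lintegral_periodicInteraction_ne_top hC (n + 1)
  -- the graph map into the form domain `Q` and the embedding `ι : Q → H = L²`
  set J := (graphEmbed hL hmeas hW).codRestrict (formDomain hL hmeas hW)
    (graphEmbed_mem_formDomain hL hmeas hW) with hJ
  have hJapply : ∀ F : periodicCore (n + 1) L,
      J F = ⟨graphEmbed hL hmeas hW F, graphEmbed_mem_formDomain hL hmeas hW F⟩ := fun F => rfl
  set ι := formEmbed hL hmeas hW with hι
  -- spectral data of the two lowest eigenvalues, and the gap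
  obtain ⟨d⟩ := nonempty_twoModeData hL hmeas hW (Nat.succ_pos n)
  have hE₀ : periodicGroundStateEnergy v (n + 1) L = ENNReal.ofReal (d.κ₁⁻¹ - 1) :=
    periodicGroundStateEnergy_eq_ofReal d
  have h1 : 1 ≤ d.κ₁⁻¹ := twoModeData_one_le_inv_κ₁ d
  have hgap : d.κ₁⁻¹ < d.κ₂⁻¹ := by
    have hlt := PeriodicGroundStateNondegenerate_holds (n + 1) L v (Nat.succ_pos n) hL hmeas ⟨C, hC⟩
    rw [hE₀, kyFanTwo_eq_ofReal d,
      show (2 : ℝ≥0∞) * ENNReal.ofReal (d.κ₁⁻¹ - 1) = ENNReal.ofReal (2 * (d.κ₁⁻¹ - 1)) by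
        rw [ENNReal.ofReal_mul zero_le_two, ENNReal.ofReal_ofNat],
      ENNReal.ofReal_lt_ofReal_iff_of_nonneg (by linarith)] at hlt
    linarith
  have hg0 : 0 < d.κ₂⁻¹ - d.κ₁⁻¹ := sub_pos.2 hgap
  -- the tolerance
  set η : ℝ := min (ε / 3) 1 with hη
  have hη0 : 0 < η := lt_min (by linarith) one_pos
  have hη1 : η ≤ 1 := min_le_right _ _
  have hηε : 2 * η + η ^ 2 ≤ ε := by nlinarith [min_le_left (ε / 3) 1]
  refine ⟨ENNReal.ofReal ((d.κ₂⁻¹ - d.κ₁⁻¹) * (η ^ 2 / 2)),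
    ENNReal.ofReal_pos.2 (by positivity), fun Ψ Φ hΨ hΦ => ?_⟩
  -- the vectors
  set FΨ : periodicCore (n + 1) L := ⟨Ψ.ψ, Ψ.mem_periodicCore⟩ with hFΨ
  set FΦ : periodicCore (n + 1) L := ⟨Φ.ψ, Φ.mem_periodicCore⟩ with hFΦ
  have huΨ : ‖ι (J FΨ)‖ = 1 := norm_formEmbed_graphEmbed_trialState hL hmeas hW Ψ
  have huΦ : ‖ι (J FΦ)‖ = 1 := norm_formEmbed_graphEmbed_trialState hL hmeas hW Φ
  have hnormJ : ∀ F : periodicCore (n + 1) L, ‖J F‖ = ‖graphEmbed hL hmeas hW F‖ := fun F => by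
    rw [hJapply]; rfl
  have hQΨ : ‖J FΨ‖ ^ 2 = 1 + (periodicEnergy v Ψ).toReal := by
    rw [hnormJ]; exact norm_graphEmbed_sq_trialState hL hmeas hW Ψ
  have hQΦ : ‖J FΦ‖ ^ 2 = 1 + (periodicEnergy v Φ).toReal := by
    rw [hnormJ]; exact norm_graphEmbed_sq_trialState hL hmeas hW Φ
  -- energies as real numbers
  have hEΨ : (periodicEnergy v Ψ).toReal = d.κ₁⁻¹ - 1 := by
    rw [hΨ, hE₀, ENNReal.toReal_ofReal (by linarith)]
  have hEΦ : (periodicEnergy v Φ).toReal ≤ d.κ₁⁻¹ - 1 + (d.κ₂⁻¹ - d.κ₁⁻¹) * (η ^ 2 / 2) := by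
    rw [hE₀, ← ENNReal.ofReal_add (by linarith) (by positivity)] at hΦ
    have := ENNReal.toReal_mono ENNReal.ofReal_ne_top hΦ
    rwa [ENNReal.toReal_ofReal (by nlinarith [sq_nonneg η])] at this
  -- the abstract stability argument: `‖ιΨ - c'•ιΦ‖² ≤ η²`
  obtain ⟨c', hc', hdist'⟩ := twoModeData_exists_phase_norm_sub_sq_le (ι := ι) d hgap
    (u := J FΨ) (w := J FΦ) huΨ huΦ (t := η ^ 2) (by linarith) (by linarith)
  -- back to functions on the cell: `∫_cell |Ψ - c'Φ|² ≤ η²`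
  have hcore : ι (J FΨ) - c' • ι (J FΦ) = ι (J (FΨ - c' • FΦ)) := by
    simp only [map_sub, map_smul]
  have hfun : ((FΨ - c' • FΦ : periodicCore (n + 1) L) : Config (n + 1) → ℂ) =
      fun X => Ψ.ψ X - c' * Φ.ψ X := by
    ext X
    simp [hFΨ, hFΦ]
  have hcontd : Continuous fun X => Ψ.ψ X - c' * Φ.ψ X :=
    Ψ.contDiff.continuous.sub (continuous_const.mul Φ.contDiff.continuous)
  have hcell : ∫⁻ X in cellN (n + 1) L, (‖Ψ.ψ X - c' * Φ.ψ X‖₊ : ℝ≥0∞) ^ 2 ≤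
      ENNReal.ofReal (η ^ 2) := by
    have hnorm : ‖ι (J (FΨ - c' • FΦ))‖ ^ 2 =
        (∫⁻ X in cellN (n + 1) L,
          (‖((FΨ - c' • FΦ : periodicCore (n + 1) L) : Config (n + 1) → ℂ) X‖₊ : ℝ≥0∞) ^ 2).toReal :=
      norm_formEmbed_graphEmbed_sq hL hmeas hW (FΨ - c' • FΦ)
    simp only [hfun, ← hcore] at hnorm
    have hfin' : (∫⁻ X in cellN (n + 1) L, (‖Ψ.ψ X - c' * Φ.ψ X‖₊ : ℝ≥0∞) ^ 2) ≠ ⊤ :=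
      (lintegral_cellN_sq_lt_top L hcontd).ne
    rw [← ENNReal.ofReal_toReal hfin', ← hnorm]
    exact ENNReal.ofReal_le_ofReal hdist'
  -- the Lipschitz estimate for `n₀`
  have hc'n : ((‖c'‖₊ : ℝ≥0) : ℝ≥0∞) = 1 := by
    rw [← ENNReal.coe_one, ENNReal.coe_inj, ← NNReal.coe_inj, coe_nnnorm, hc', NNReal.coe_one]
  have hcontg : Continuous fun X => c' * Φ.ψ X := continuous_const.mul Φ.contDiff.continuous
  have hg1 : ∫⁻ X in cellN (n + 1) L, (‖c' * Φ.ψ X‖₊ : ℝ≥0∞) ^ 2 ≤ 1 := by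
    have hX : ∀ X, (‖c' * Φ.ψ X‖₊ : ℝ≥0∞) ^ 2 = (‖Φ.ψ X‖₊ : ℝ≥0∞) ^ 2 := fun X => by
      rw [nnnorm_mul, ENNReal.coe_mul, mul_pow, hc'n, one_pow, one_mul]
    simp only [hX]
    rw [Φ.norm_eq]
  have hmain := condensateOccupation_le_of_sub_le hL Ψ.contDiff.continuous hcontg hg1 hη0 hcell
  rw [condensateOccupation_const_mul hL c' Φ.ψ, hc'n, one_pow, one_mul] at hmain
  refine hmain.trans (add_le_add le_rfl (ENNReal.ofReal_le_ofReal ?_))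
  rw [mul_comm]
  exact mul_le_mul_of_nonneg_right hηε (Nat.cast_nonneg _)

/-! ### From the positive ground state to all near-minimisers, along `L_N = (N/ρ)^{1/3}` -/

/-- **Ground-state BEC propagates to all near-minimisers (bounded class).** Let `v ≤ M < ∞` be
admissible and `ρ > 0`, `c > 0`. If for all large `N` every NONNEGATIVE minimiser `Ψ` of the periodic
`N`-body energy in the box of side `L_N = (N/ρ)^{1/3}` has `n₀(Ψ) ≥ cN`, then for all large `N` there
is `δ_N > 0` such that EVERY `δ_N`-near-minimiser `Φ` (no sign condition) has `n₀(Φ) ≥ (c/2)N`: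
a positive `C¹` minimiser exists (`boundedPositiveMinimiser_holds`), and near-minimiser stability with
`ε = c/2` transfers its condensate. [cite: ReedSimonIV1978, §XIII.12 Thms XIII.43–XIII.47] -/
theorem eventually_nearMinimiser_condensate_of_groundState {v : ℝ → ℝ≥0∞}
    (hv : IsRepulsiveFiniteRange v) {M : ℝ≥0} (hM : ∀ r, v r ≤ M) {ρ c : ℝ} (hρ : 0 < ρ)
    (hc : 0 < c)
    (hgs : ∀ᶠ N : ℕ in atTop, ∀ Ψ : PeriodicTrialState N (sideLength ρ N),
      periodicEnergy v Ψ = periodicGroundStateEnergy v N (sideLength ρ N) →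
      (∀ X, Ψ.ψ X = ((‖Ψ.ψ X‖ : ℝ) : ℂ)) →
      ENNReal.ofReal (c * N) ≤ condensateOccupation N (sideLength ρ N) Ψ.ψ) :
    ∀ᶠ N : ℕ in atTop, ∃ δ : ℝ≥0∞, 0 < δ ∧ ∀ Φ : PeriodicTrialState N (sideLength ρ N),
      periodicEnergy v Φ ≤ periodicGroundStateEnergy v N (sideLength ρ N) + δ →
      ENNReal.ofReal (c / 2 * N) ≤ condensateOccupation N (sideLength ρ N) Φ.ψ := by
  filter_upwards [hgs, eventually_ne_atTop 0] with N hN hN0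
  obtain ⟨n, rfl⟩ := Nat.exists_eq_succ_of_ne_zero hN0
  have hL : 0 < sideLength ρ (n + 1) := by
    unfold sideLength
    exact Real.rpow_pos_of_pos (div_pos (by positivity) hρ) _
  -- the positive `C¹` minimiser and its condensate
  obtain ⟨Ψ₀, hE, -, hpos, -⟩ :=
    boundedPositiveMinimiser_holds hv ⟨(M : ℝ≥0∞), ENNReal.coe_ne_top, fun r => hM r⟩ n hL
  have h1 : ENNReal.ofReal (c * (n + 1 : ℕ)) ≤ condensateOccupation (n + 1) (sideLength ρ (n + 1)) Ψ₀.ψ :=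
    hN Ψ₀ hE hpos
  -- stability with `ε = c/2`
  obtain ⟨δ, hδ, hstab⟩ := nearMinimiserStability_of_bounded hv hM (n + 1) hL (half_pos hc)
  refine ⟨δ, hδ, fun Φ hΦ => ?_⟩
  have h2 := hstab Ψ₀ Φ hE hΦ
  have hnn : 0 ≤ c / 2 * ((n + 1 : ℕ) : ℝ) := by positivity
  have hsub : ENNReal.ofReal (c / 2 * (n + 1 : ℕ)) =
      ENNReal.ofReal (c * (n + 1 : ℕ)) - ENNReal.ofReal (c / 2 * (n + 1 : ℕ)) := by
    rw [← ENNReal.ofReal_sub _ hnn]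
    congr 1
    ring
  calc ENNReal.ofReal (c / 2 * (n + 1 : ℕ))
      = ENNReal.ofReal (c * (n + 1 : ℕ)) - ENNReal.ofReal (c / 2 * (n + 1 : ℕ)) := hsub
    _ ≤ condensateOccupation (n + 1) (sideLength ρ (n + 1)) Φ.ψ + ENNReal.ofReal (c / 2 * (n + 1 : ℕ))
          - ENNReal.ofReal (c / 2 * (n + 1 : ℕ)) := tsub_le_tsub_right (h1.trans h2) _
    _ = condensateOccupation (n + 1) (sideLength ρ (n + 1)) Φ.ψ :=
          ENNReal.add_sub_cancel_right ENNReal.ofReal_ne_top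

/-! ### The bounded sector of the node is ground-state BEC -/

/-- **Unsigned periodic BEC from ground-state BEC (bounded class).** For admissible `v ≤ M < ∞`:
if there is `ρ₀ > 0` such that for `0 < ρ < ρ₀` some `c > 0` bounds the condensate of every
nonnegative minimiser, `n₀ ≥ cN` for all large `N`, then the unsigned periodic-BEC body holds for `v`
(every `δ_N`-near-minimiser has `n₀ ≥ (c/2)N`). [cite: ReedSimonIV1978, §XIII.12] -/
theorem periodicBEC_body_of_groundStateBEC_bounded {v : ℝ → ℝ≥0∞} (hv : IsRepulsiveFiniteRange v)
    {M : ℝ≥0} (hM : ∀ r, v r ≤ M)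
    (hgs : ∃ ρ₀ : ℝ, 0 < ρ₀ ∧ ∀ ρ : ℝ, 0 < ρ → ρ < ρ₀ → ∃ c : ℝ, 0 < c ∧ ∀ᶠ N : ℕ in atTop,
      ∀ Ψ : PeriodicTrialState N (sideLength ρ N),
        periodicEnergy v Ψ = periodicGroundStateEnergy v N (sideLength ρ N) →
        (∀ X, Ψ.ψ X = ((‖Ψ.ψ X‖ : ℝ) : ℂ)) →
        ENNReal.ofReal (c * N) ≤ condensateOccupation N (sideLength ρ N) Ψ.ψ) :
    ∃ ρ₀ : ℝ, 0 < ρ₀ ∧ ∀ ρ : ℝ, 0 < ρ → ρ < ρ₀ → ∃ c : ℝ, 0 < c ∧ ∀ᶠ N : ℕ in atTop,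
      ∃ δ : ℝ≥0∞, 0 < δ ∧ ∀ Ψ : PeriodicTrialState N (sideLength ρ N),
        periodicEnergy v Ψ ≤ periodicGroundStateEnergy v N (sideLength ρ N) + δ →
        ENNReal.ofReal (c * N) ≤ condensateOccupation N (sideLength ρ N) Ψ.ψ := by
  obtain ⟨ρ₀, hρ₀, h⟩ := hgs
  refine ⟨ρ₀, hρ₀, fun ρ hρ hρlt => ?_⟩
  obtain ⟨c, hc, hN⟩ := h ρ hρ hρlt
  exact ⟨c / 2, half_pos hc, eventually_nearMinimiser_condensate_of_groundState hv hM hρ hc hN⟩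

/-- **The node body from ground-state BEC (bounded class)**: as
`periodicBEC_body_of_groundStateBEC_bounded`, with the (now idle) sign hypothesis of
`PeriodicBECNonneg` reinstated. [cite: ReedSimonIV1978, §XIII.12] -/
theorem periodicBECNonneg_body_of_groundStateBEC_bounded {v : ℝ → ℝ≥0∞}
    (hv : IsRepulsiveFiniteRange v) {M : ℝ≥0} (hM : ∀ r, v r ≤ M)
    (hgs : ∃ ρ₀ : ℝ, 0 < ρ₀ ∧ ∀ ρ : ℝ, 0 < ρ → ρ < ρ₀ → ∃ c : ℝ, 0 < c ∧ ∀ᶠ N : ℕ in atTop,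
      ∀ Ψ : PeriodicTrialState N (sideLength ρ N),
        periodicEnergy v Ψ = periodicGroundStateEnergy v N (sideLength ρ N) →
        (∀ X, Ψ.ψ X = ((‖Ψ.ψ X‖ : ℝ) : ℂ)) →
        ENNReal.ofReal (c * N) ≤ condensateOccupation N (sideLength ρ N) Ψ.ψ) :
    ∃ ρ₀ : ℝ, 0 < ρ₀ ∧ ∀ ρ : ℝ, 0 < ρ → ρ < ρ₀ → ∃ c : ℝ, 0 < c ∧ ∀ᶠ N : ℕ in atTop,
      ∃ δ : ℝ≥0∞, 0 < δ ∧ ∀ Ψ : PeriodicTrialState N (sideLength ρ N),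
        periodicEnergy v Ψ ≤ periodicGroundStateEnergy v N (sideLength ρ N) + δ →
        (∀ X, Ψ.ψ X = ((‖Ψ.ψ X‖ : ℝ) : ℂ)) →
        ENNReal.ofReal (c * N) ≤ condensateOccupation N (sideLength ρ N) Ψ.ψ := by
  obtain ⟨ρ₀, hρ₀, h⟩ := periodicBEC_body_of_groundStateBEC_bounded hv hM hgs
  refine ⟨ρ₀, hρ₀, fun ρ hρ hρlt => ?_⟩
  obtain ⟨c, hc, hN⟩ := h ρ hρ hρlt
  refine ⟨c, hc, ?_⟩
  filter_upwards [hN] with N ⟨δ, hδ, hΨ⟩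
  exact ⟨δ, hδ, fun Ψ hE _ => hΨ Ψ hE⟩

/-- **Ground-state BEC from the node body (every admissible `v`)**: a minimiser is a
`δ`-near-minimiser for every `δ > 0`, so the node's conclusion applies to nonnegative minimisers with
the same `ρ₀` and `c`. [folklore] -/
theorem groundStateBEC_of_periodicBECNonneg_body {v : ℝ → ℝ≥0∞}
    (h : ∃ ρ₀ : ℝ, 0 < ρ₀ ∧ ∀ ρ : ℝ, 0 < ρ → ρ < ρ₀ → ∃ c : ℝ, 0 < c ∧ ∀ᶠ N : ℕ in atTop,
      ∃ δ : ℝ≥0∞, 0 < δ ∧ ∀ Ψ : PeriodicTrialState N (sideLength ρ N),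
        periodicEnergy v Ψ ≤ periodicGroundStateEnergy v N (sideLength ρ N) + δ →
        (∀ X, Ψ.ψ X = ((‖Ψ.ψ X‖ : ℝ) : ℂ)) →
        ENNReal.ofReal (c * N) ≤ condensateOccupation N (sideLength ρ N) Ψ.ψ) :
    ∃ ρ₀ : ℝ, 0 < ρ₀ ∧ ∀ ρ : ℝ, 0 < ρ → ρ < ρ₀ → ∃ c : ℝ, 0 < c ∧ ∀ᶠ N : ℕ in atTop,
      ∀ Ψ : PeriodicTrialState N (sideLength ρ N),
        periodicEnergy v Ψ = periodicGroundStateEnergy v N (sideLength ρ N) →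
        (∀ X, Ψ.ψ X = ((‖Ψ.ψ X‖ : ℝ) : ℂ)) →
        ENNReal.ofReal (c * N) ≤ condensateOccupation N (sideLength ρ N) Ψ.ψ := by
  obtain ⟨ρ₀, hρ₀, h⟩ := h
  refine ⟨ρ₀, hρ₀, fun ρ hρ hρlt => ?_⟩
  obtain ⟨c, hc, hN⟩ := h ρ hρ hρlt
  refine ⟨c, hc, ?_⟩
  filter_upwards [hN] with N ⟨δ, _, hΨ⟩
  exact fun Ψ hE hpos => hΨ Ψ (hE ▸ le_self_add) hpos

/-- **On the bounded sector the node IS ground-state BEC**: for admissible `v ≤ M < ∞`, the body of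
`PeriodicBECNonneg` at `v` holds iff there is `ρ₀ > 0` such that for `0 < ρ < ρ₀` some `c > 0` bounds
the condensate of every nonnegative minimiser (equivalently, by `boundedPositiveMinimiser_holds` and
simplicity of the ground state, of THE positive ground state), `n₀ ≥ cN`, for all large `N`.
[cite: ReedSimonIV1978, §XIII.12] -/
theorem periodicBECNonneg_body_iff_groundStateBEC_bounded {v : ℝ → ℝ≥0∞}
    (hv : IsRepulsiveFiniteRange v) {M : ℝ≥0} (hM : ∀ r, v r ≤ M) :
    (∃ ρ₀ : ℝ, 0 < ρ₀ ∧ ∀ ρ : ℝ, 0 < ρ → ρ < ρ₀ → ∃ c : ℝ, 0 < c ∧ ∀ᶠ N : ℕ in atTop,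
      ∃ δ : ℝ≥0∞, 0 < δ ∧ ∀ Ψ : PeriodicTrialState N (sideLength ρ N),
        periodicEnergy v Ψ ≤ periodicGroundStateEnergy v N (sideLength ρ N) + δ →
        (∀ X, Ψ.ψ X = ((‖Ψ.ψ X‖ : ℝ) : ℂ)) →
        ENNReal.ofReal (c * N) ≤ condensateOccupation N (sideLength ρ N) Ψ.ψ) ↔
    (∃ ρ₀ : ℝ, 0 < ρ₀ ∧ ∀ ρ : ℝ, 0 < ρ → ρ < ρ₀ → ∃ c : ℝ, 0 < c ∧ ∀ᶠ N : ℕ in atTop,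
      ∀ Ψ : PeriodicTrialState N (sideLength ρ N),
        periodicEnergy v Ψ = periodicGroundStateEnergy v N (sideLength ρ N) →
        (∀ X, Ψ.ψ X = ((‖Ψ.ψ X‖ : ℝ) : ℂ)) →
        ENNReal.ofReal (c * N) ≤ condensateOccupation N (sideLength ρ N) Ψ.ψ) :=
  ⟨groundStateBEC_of_periodicBECNonneg_body, periodicBECNonneg_body_of_groundStateBEC_bounded hv hM⟩

/-- **Bounded sector of `PositivityReduction` (item stmt-AtomisticToContinuum-11998), for free**: for
admissible `v ≤ M < ∞` the node body at `v` implies the unsigned periodic-BEC body at `v` (constant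
halved), through the positive ground state: node ⇒ ground-state BEC ⇒ all near-minimisers.
[cite: ReedSimonIV1978, §XIII.12] -/
theorem periodicBEC_body_of_periodicBECNonneg_body_bounded {v : ℝ → ℝ≥0∞}
    (hv : IsRepulsiveFiniteRange v) {M : ℝ≥0} (hM : ∀ r, v r ≤ M)
    (h : ∃ ρ₀ : ℝ, 0 < ρ₀ ∧ ∀ ρ : ℝ, 0 < ρ → ρ < ρ₀ → ∃ c : ℝ, 0 < c ∧ ∀ᶠ N : ℕ in atTop,
      ∃ δ : ℝ≥0∞, 0 < δ ∧ ∀ Ψ : PeriodicTrialState N (sideLength ρ N),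
        periodicEnergy v Ψ ≤ periodicGroundStateEnergy v N (sideLength ρ N) + δ →
        (∀ X, Ψ.ψ X = ((‖Ψ.ψ X‖ : ℝ) : ℂ)) →
        ENNReal.ofReal (c * N) ≤ condensateOccupation N (sideLength ρ N) Ψ.ψ) :
    ∃ ρ₀ : ℝ, 0 < ρ₀ ∧ ∀ ρ : ℝ, 0 < ρ → ρ < ρ₀ → ∃ c : ℝ, 0 < c ∧ ∀ᶠ N : ℕ in atTop,
      ∃ δ : ℝ≥0∞, 0 < δ ∧ ∀ Ψ : PeriodicTrialState N (sideLength ρ N),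
        periodicEnergy v Ψ ≤ periodicGroundStateEnergy v N (sideLength ρ N) + δ →
        ENNReal.ofReal (c * N) ≤ condensateOccupation N (sideLength ρ N) Ψ.ψ :=
  periodicBEC_body_of_groundStateBEC_bounded hv hM (groundStateBEC_of_periodicBECNonneg_body h)

/-! ### The node from ground-state BEC -/

/-- **`PeriodicBECNonneg` from ground-state BEC.** The node follows from: (i) ground-state BEC for
every BOUNDED admissible potential — `∃ ρ₀ > 0, ∀ ρ ∈ (0, ρ₀), ∃ c > 0`, for all large `N` every
nonnegative periodic minimiser at side `(N/ρ)^{1/3}` has `n₀ ≥ cN` — and (ii) the node body itself for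
the unbounded admissible potentials (hard cores and unbounded finite profiles, where the existence of
`C¹` minimisers is not available in the tree). [cite: ReedSimonIV1978, §XIII.12] -/
theorem periodicBECNonneg_of_groundStateBEC
    (hgs : ∀ v : ℝ → ℝ≥0∞, IsRepulsiveFiniteRange v → ∀ M : ℝ≥0, (∀ r, v r ≤ M) →
      ∃ ρ₀ : ℝ, 0 < ρ₀ ∧ ∀ ρ : ℝ, 0 < ρ → ρ < ρ₀ → ∃ c : ℝ, 0 < c ∧ ∀ᶠ N : ℕ in atTop,
        ∀ Ψ : PeriodicTrialState N (sideLength ρ N),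
          periodicEnergy v Ψ = periodicGroundStateEnergy v N (sideLength ρ N) →
          (∀ X, Ψ.ψ X = ((‖Ψ.ψ X‖ : ℝ) : ℂ)) →
          ENNReal.ofReal (c * N) ≤ condensateOccupation N (sideLength ρ N) Ψ.ψ)
    (hunb : ∀ v : ℝ → ℝ≥0∞, IsRepulsiveFiniteRange v → (¬ ∃ M : ℝ≥0, ∀ r, v r ≤ M) →
      ∃ ρ₀ : ℝ, 0 < ρ₀ ∧ ∀ ρ : ℝ, 0 < ρ → ρ < ρ₀ → ∃ c : ℝ, 0 < c ∧ ∀ᶠ N : ℕ in atTop,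
        ∃ δ : ℝ≥0∞, 0 < δ ∧ ∀ Ψ : PeriodicTrialState N (sideLength ρ N),
          periodicEnergy v Ψ ≤ periodicGroundStateEnergy v N (sideLength ρ N) + δ →
          (∀ X, Ψ.ψ X = ((‖Ψ.ψ X‖ : ℝ) : ℂ)) →
          ENNReal.ofReal (c * N) ≤ condensateOccupation N (sideLength ρ N) Ψ.ψ) :
    PeriodicBECNonneg := by
  intro v hv
  by_cases hb : ∃ M : ℝ≥0, ∀ r, v r ≤ M
  · obtain ⟨M, hM⟩ := hb
    exact periodicBECNonneg_body_of_groundStateBEC_bounded hv hM (hgs v hv M hM)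
  · exact hunb v hv hb

/-- **The node implies ground-state BEC for every admissible potential** (the cheap converse of
`periodicBECNonneg_of_groundStateBEC`, no boundedness needed). [folklore] -/
theorem groundStateBEC_of_periodicBECNonneg (h : PeriodicBECNonneg) :
    ∀ v : ℝ → ℝ≥0∞, IsRepulsiveFiniteRange v →
      ∃ ρ₀ : ℝ, 0 < ρ₀ ∧ ∀ ρ : ℝ, 0 < ρ → ρ < ρ₀ → ∃ c : ℝ, 0 < c ∧ ∀ᶠ N : ℕ in atTop,
        ∀ Ψ : PeriodicTrialState N (sideLength ρ N),
          periodicEnergy v Ψ = periodicGroundStateEnergy v N (sideLength ρ N) →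
          (∀ X, Ψ.ψ X = ((‖Ψ.ψ X‖ : ℝ) : ℂ)) →
          ENNReal.ofReal (c * N) ≤ condensateOccupation N (sideLength ρ N) Ψ.ψ :=
  fun v hv => groundStateBEC_of_periodicBECNonneg_body (h v hv)

end Summit.AtomisticToContinuum.BoseEinsteinCondensation.Theorems

end
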